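import Summits.CriticalPhenomena.PercolationContinuityZ3.Theorems.PercNearOneGluingNoHeavyLowerTailSahiAbsorbedSaturation
import Summits.CriticalPhenomena.PercolationContinuityZ3.Theorems.SahiMasterFamilyWidthCollapse
import Literature.Combinatorics.Sahi2008.Percolation

/-!
# Sahi's conjecture at EVERY order on the cube `{0,1}^5`, every product measure ⟸ six finite coloured-antichain conditions (orders `5, …, 10`)

Support file (cell `prim-sahi`, seat `prim-sahi-typer` gen 28; `--supports stmt-CriticalPhenomena-4575`).  Pure proofs, no definitions, no `sorry`,
standard axioms.  The reduction behind the cell's census "all orders on five coins" (typer gen 28 memo §6); the tree has all orders on FOUR coins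
(`NCopyCert.sahiPositive_bernoulliWeight_fin_four`, computational) and orders `≤ 4` on five coins (`SahiC4Cube.sahiPositive_bernoulliWeight_fin_five_of_le_four`,
computational; taken here as the hypothesis `h4` so that this file has standard axioms).

* `filter_coMember_eq_univ_of_forall_ne` — a colour not used on the antichain generates the whole poset;
* **`sahiPositive_of_surjColouring`** (every weight `μ ≥ 0` of mass one on a finite partial order, given `C_k(μ)`, `k ≤ n+1`): `C_{n+2}(μ)` follows from
  `E_{n+2} ≥ 0` on the families co-generated by `(n+2)`-coloured antichains whose colouring USES ALL `n+2` COLOURS (the others have a member `= 1` and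
  reduce to the order below by branching `E_{n+2}(1, g) = n·E_{n+1}(g)`, `sahiE_succ_succ_of_head_eq_one`) — refines typer gen 27's
  `SahiAbsorbed.sahiPositive_of_colouring`;
* `set_fin_five_width` — any `C(5,2) + 1 = 11` subsets of `Fin 5` contain a comparable pair (Sperner, from `SahiWidthCollapse.finset_width_le_choose`);
* **`sahiPositive_bernoulliWeight_all_fin_five_of_cores`** — for `p : Fin 5 → [0,1]`: if `C_n(μ_p)` holds for `n ≤ 4` and, for each order `n ∈ {5,…,10}`,
  `E_n ≥ 0` on the families co-generated by the all-colour `n`-coloured antichains of `Set (Fin 5)`, then `SahiPositive (bernoulliWeight p) n` for EVERY `n`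
  (width collapse `SahiWidthCollapse.sahiPositive_all_of_width`: on `2^{Fin 5}` orders `≤ 10` suffice).  The six finite conditions concern
  `Σ_N S(|N|,n)` = 436 266, 140 834, 24 710, 2 335, 110, 2 coloured antichains (orders 5, …, 10; restricted growth) — a census outside Lean, see the memo.
[this work]
-/

namespace Summit.CriticalPhenomena.PercolationContinuityZ3.Theorems

open Finset Function Equiv
open Literature.Combinatorics.Sahi2008

namespace SahiAbsorbed

section Surjective

open scoped Classical

variable {α : Type*} [Fintype α] [PartialOrder α] {μ : α → ℝ} {n : ℕ}

omit [Fintype α] in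
/-- A co-generated member is an up-set. [this work] -/
theorem isUpperSet_filter_coMember [Fintype α] {k : ℕ} (N : Finset α) (c : α → Fin k) (i : Fin k) :
    IsUpperSet ((univ.filter fun q : α => ∀ p ∈ N, c p = i → ¬ q ≤ p : Finset α) : Set α) := by
  intro a b hab ha
  rw [mem_coe, mem_filter] at ha ⊢
  exact ⟨mem_univ _, fun p hp hcp hbp => ha.2 p hp hcp (hab.trans hbp)⟩

/-- A colour that is not used on `N` generates the whole poset. [this work] -/
theorem filter_coMember_eq_univ_of_forall_ne {k : ℕ} (N : Finset α) (c : α → Fin k) {i : Fin k} (hi : ∀ p ∈ N, c p ≠ i) :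
    (univ.filter fun q : α => ∀ p ∈ N, c p = i → ¬ q ≤ p) = univ := by
  refine eq_univ_of_forall fun q => mem_filter.2 ⟨mem_univ _, fun p hp hcp _ => hi p hp hcp⟩

omit [PartialOrder α] in
/-- The indicator of everything is the constant `1`. [this work] -/
theorem setInd_univ_eq_one : setInd (univ : Finset α) = fun _ => (1 : ℝ) := by
  funext x; simp [setInd_apply]

/-- **SURJECTIVE COLOURINGS SUFFICE** (every weight `μ ≥ 0` of mass one, given `C_k(μ)` for `k ≤ n+1`): `C_{n+2}(μ)` follows from `E_{n+2} ≥ 0` on the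
families co-generated by coloured antichains `(N, c)` whose colouring uses all `n+2` colours on `N`. [this work] -/
theorem sahiPositive_of_surjColouring (hμ0 : ∀ x, 0 ≤ μ x) (hμ1 : ∑ x, μ x = 1) (hpos : ∀ k, 1 ≤ k → k ≤ n + 1 → SahiPositive μ k)
    (h : ∀ (N : Finset α) (c : α → Fin (n + 2)), IsAntichain (· ≤ ·) (N : Set α) → (∀ i : Fin (n + 2), ∃ p ∈ N, c p = i) →
      0 ≤ sahiE μ (n + 2) (fun i => setInd (univ.filter fun q : α => ∀ p ∈ N, c p = i → ¬ q ≤ p))) :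
    SahiPositive μ (n + 2) := by
  refine sahiPositive_of_colouring hμ0 hpos fun N c hN => ?_
  by_cases hsurj : ∀ i : Fin (n + 2), ∃ p ∈ N, c p = i
  · exact h N c hN hsurj
  push Not at hsurj
  obtain ⟨i₀, hi₀⟩ := hsurj
  set F : Fin (n + 2) → α → ℝ := fun i => setInd (univ.filter fun q : α => ∀ p ∈ N, c p = i → ¬ q ≤ p) with hF
  have hFi₀ : F i₀ = fun _ => 1 := by
    simp only [hF]
    rw [filter_coMember_eq_univ_of_forall_ne N c hi₀, setInd_univ_eq_one]
  -- move the trivial member to the head and branch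
  rw [← sahiE_comp_perm μ (n + 2) (swap 0 i₀) F, comp_swap_eq_cons F i₀]
  rw [sahiE_succ_succ_of_head_eq_one hμ1 _ (by rw [Fin.cons_zero, hFi₀]; rfl), Fin.tail_cons]
  refine mul_nonneg (Nat.cast_nonneg _) ?_
  rcases Nat.eq_zero_or_pos n with hn | hn
  · subst hn
    -- order `1`: `E_1(g) = E(g) ≥ 0`
    exact sahiPositive_one hμ0 _ (fun _ _ => setInd_nonneg _ _) (fun k => monotone_setInd (isUpperSet_filter_coMember N c _))
  · exact hpos (n + 1) (by omega) le_rfl _ (fun _ _ => setInd_nonneg _ _)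
      (fun k => monotone_setInd (isUpperSet_filter_coMember N c _))

end Surjective

end SahiAbsorbed

/-! ## Five coins: the width collapse and the reduction to orders `5, …, 10` -/

namespace SahiCubeFive

open SahiAbsorbed

/-- **Width of `Set (Fin 5)`**: among any `C(5,2) + 1 = 11` subsets of `Fin 5` two are comparable (Sperner). [this work] -/
theorem set_fin_five_width (y : Fin ((Fintype.card (Fin 5)).choose (Fintype.card (Fin 5) / 2) + 1) → Set (Fin 5)) :
    ∃ i j, i ≠ j ∧ y i ≤ y j := by
  classical
  obtain ⟨i, j, hij, hle⟩ := SahiWidthCollapse.finset_width_le_choose (fun i => (y i).toFinset)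
  refine ⟨i, j, hij, fun a ha => ?_⟩
  have h := hle (Set.mem_toFinset.mpr ha)
  exact Set.mem_toFinset.mp h

open scoped Classical in
/-- **SAHI'S CONJECTURE AT EVERY ORDER ON FIVE COINS FROM SIX FINITE CONDITIONS.**  For a product weight `μ_p` on `2^{Fin 5}`: if `C_n(μ_p)` holds for
`n ≤ 4` and, for every order `n + 2 ∈ {5, …, 10}`, `E_{n+2}(1_{U_0}, …, 1_{U_{n+1}}) ≥ 0` for the families `U_i = {S | ∀ T ∈ N, c T = i → ¬ S ⊆ T}`
co-generated by the antichains `N ⊆ Set (Fin 5)` with a colouring `c` using all `n + 2` colours on `N`, then `SahiPositive (bernoulliWeight p) n` for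
EVERY `n`. [this work] -/
theorem sahiPositive_bernoulliWeight_all_fin_five_of_cores (p : Fin 5 → unitInterval)
    (h4 : ∀ n, n ≤ 4 → SahiPositive (bernoulliWeight p) n)
    (hcore : ∀ n : ℕ, 3 ≤ n → n ≤ 8 → ∀ (N : Finset (Set (Fin 5))) (c : Set (Fin 5) → Fin (n + 2)),
      IsAntichain (· ≤ ·) (N : Set (Set (Fin 5))) → (∀ i : Fin (n + 2), ∃ T ∈ N, c T = i) →
      0 ≤ sahiE (bernoulliWeight p) (n + 2) (fun i => setInd (univ.filter fun q : Set (Fin 5) => ∀ T ∈ N, c T = i → ¬ q ≤ T))) :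
    ∀ n, SahiPositive (bernoulliWeight p) n := by
  have hμ0 := (isFKGMeasure_bernoulliWeight p).nonneg
  have hμ1 := (isFKGMeasure_bernoulliWeight p).sum_eq_one
  -- orders `≤ 10` by strong induction through the coloured cores
  have h10 : ∀ n, n ≤ 10 → SahiPositive (bernoulliWeight p) n := by
    intro n
    induction n using Nat.strong_induction_on with
    | _ n ih =>
      intro hn
      by_cases hn4 : n ≤ 4
      · exact h4 n hn4
      · obtain ⟨k, rfl⟩ : ∃ k, n = k + 2 := ⟨n - 2, by omega⟩
        exact sahiPositive_of_surjColouring hμ0 hμ1 (fun j hj1 hj2 => ih j (by omega) (by omega))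
          (hcore k (by omega) (by omega))
  -- width collapse: on `2^{Fin 5}` orders `≤ max 10 2` suffice
  refine SahiWidthCollapse.sahiPositive_all_of_width (bernoulliWeight p) hμ0 hμ1 set_fin_five_width fun n hn => h10 n ?_
  have hmax : max ((Fintype.card (Fin 5)).choose (Fintype.card (Fin 5) / 2)) 2 = 10 := by
    simp only [Fintype.card_fin]; decide
  rw [hmax] at hn
  exact hn

end SahiCubeFive

end Summit.CriticalPhenomena.PercolationContinuityZ3.Theorems
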